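import Literature.NumberTheory.Rogawski1990.CartanObstructionSumZero
import Literature.NumberTheory.Rogawski1990.CartanObstructionConj
import HarnessLib

/-!
# The obstruction `cartanObs : 𝒞′_𝐀(γ₀) → A(T) = {ε ∈ (ℤ∕2)^{ι} ∣ ∑ ε = 0}` of a regular stable class of `U(H)`, valued in the sum-zero hyperplane
# (Rogawski 1990, §3.3 (3.3.1) p. 22, §3.5 Prop. 3.5.2 (c) p. 29; Kottwitz 1986 §9)

Topic `NumberTheory/Rogawski1990`; namespace `Literature.NumberTheory.Rogawski1990`; ONE definition with body + theorems; **no named fact, no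
`sorry`, no instance, no notation**.  Cell `pub/hodgecm-mathlib`, ENGINE T1 (crux H413 = `stmt-HodgeConjecture-24833`), row G6, sub-row R6d (D) of
`BLUEPRINT-R6dR7-CartanObsHasse.F0P5a-p03g4` (0a35b92f): the `↥(cartanObsSubgroup ι)`-valued obstruction that ★ R7a `StabilisationPackageOfObsHasse`,
★ P5 `cartanObsHasse_of_steps`, F0P5a-p03 (g5)'s R7 `CartanObsHasse` and A-p06's F5 `TransferFactsCartanKappa` quantify over — `cartanObsFun` (★ (A)
`CartanObstruction`) packaged with the sum-zero theorem (★ (C2) `CartanObstructionSumZero`), with the GLOBAL reading (★ (B) `CartanObstructionGlobal`)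
and the class-function property (★ (E) `CartanObstructionConj`) transported.  TYPING CONVENTION (F0P5a-p03 (g5) TRUNK WORDS #3): the `Fintype` structure
on `ι = cartanIndexCM hH hHd hreg` is a BINDER of every declaration (no global instance exists; consumers open `haveI := Fintype.ofFinite _` from ★
`finite_cartanIndex`); no instance term appears inside any statement.  HC_CM is proved only modulo the printed citations until rung 0 closes.

THE PRINT.  [Rogawski1990, §3.3 p. 22]: `obs(γ′) ∈ A(G_γ^d)`, with [Prop. 3.3.1] `obs(γ′) = 0 ⟺ γ′` is `G(𝐀)`-conjugate to a rational element; [§3.5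
Prop. 3.5.2 (c) p. 29]: `A(T) = {(ε_j) : ∑ ε_j = 0}` over the τ-stable field factors of the Cartan algebra; [Kottwitz1986, §9].

WHAT IS TYPED.
* **`MatchingAdeleG₂.cartanObs hH hHd hreg [Fintype ι] p : ↥(cartanObsSubgroup (cartanIndexCM hH hHd hreg))`** := `⟨cartanObsFun p, ∑ = 0⟩`;
  `@[simp] coe_cartanObs` (`↑(cartanObs p) = cartanObsFun p`, `rfl`); `cartanObs_eq_zero_iff` (`= 0 ↔ cartanObsFun p = 0`).
* **`MatchingAdeleG₂.cartanObs_eq_zero_iff_exists_global`** — P4 = the `hglob` binder of ★ P5 `cartanObsHasse_of_steps` at `obs := cartanObs` (★ (B) transported).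
* `MatchingAdeleG₂.cartanObs_eq_of_isConjAdele` — class function (★ (E) transported).

## References
* [Rogawski1990] J. D. Rogawski, *Automorphic Representations of Unitary Groups in Three Variables*, Ann. of Math. Stud. 123 (1990), §3.3 (3.3.1),
  Prop. 3.3.1 p. 22; §3.5 Prop. 3.5.2 (c) p. 29.
* [Kottwitz1986] R. E. Kottwitz, *Stable trace formula: elliptic singular terms*, Math. Ann. 275 (1986), §9.
-/

set_option autoImplicit false

noncomputable section

open NumberField IsDedekindDomain
open scoped TensorProduct Matrix MatrixGroups

namespace Literature.NumberTheory.Rogawski1990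

open Literature.NumberTheory.Automorphic Literature.NumberTheory.GaloisRepresentations
open Literature.AlgebraicGeometry.ShimuraVarieties (unitaryGroup)

section Subgroup

variable {L : Type} [Field L] [NumberField L] [IsCMField L] {H : Matrix (Fin 3) (Fin 3) L} {γ₀ : (UnitaryGroup.cmDatum L 3 H).Rational}

/-- **`cartanObs p ∈ A(T)`** — the obstruction of the adelic class `p ∈ 𝒞′_𝐀(γ₀)` as an element of the sum-zero hyperplane
`cartanObsSubgroup ι ≤ (ι → ℤ∕2)` over the τ-stable factors `ι = cartanIndexCM` of the Cartan algebra `L[γ₀]`: the vector ★ `cartanObsFun p` with the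
certificate ★ `sum_cartanObsFun_eq_zero`.  The `Fintype ι` structure is a binder (consumers: `Fintype.ofFinite` from ★ `finite_cartanIndex`).
[cite: Rogawski1990, §3.3 (3.3.1) p. 22; §3.5 Prop. 3.5.2 (c) p. 29] [cite: Kottwitz1986, §9] -/
def MatchingAdeleG₂.cartanObs (hH : (H.map (cmConjRingHom L))ᵀ = H) (hHd : IsUnit H.det)
    (hreg : IsRegularElt ((γ₀ : unitaryGroup (cmConjRingHom L) H).val : GL (Fin 3) L)) [Fintype (cartanIndexCM hH hHd hreg)]
    (p : MatchingAdeleG₂ L H H γ₀) : ↥(cartanObsSubgroup (cartanIndexCM hH hHd hreg)) :=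
  ⟨p.cartanObsFun hH hHd hreg, (mem_cartanObsSubgroup_iff _).2 (p.sum_cartanObsFun_eq_zero hH hHd hreg)⟩

/-- `↑(cartanObs p) = cartanObsFun p`. [cite: Rogawski1990, §3.3 (3.3.1) p. 22] -/
@[simp] theorem MatchingAdeleG₂.coe_cartanObs (hH : (H.map (cmConjRingHom L))ᵀ = H) (hHd : IsUnit H.det)
    (hreg : IsRegularElt ((γ₀ : unitaryGroup (cmConjRingHom L) H).val : GL (Fin 3) L)) [Fintype (cartanIndexCM hH hHd hreg)]
    (p : MatchingAdeleG₂ L H H γ₀) :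
    ((p.cartanObs hH hHd hreg : ↥(cartanObsSubgroup (cartanIndexCM hH hHd hreg))) : cartanIndexCM hH hHd hreg → ZMod 2) = p.cartanObsFun hH hHd hreg :=
  rfl

/-- `cartanObs p = 0 ↔ cartanObsFun p = 0`. [cite: Rogawski1990, §3.3 (3.3.1) p. 22] -/
theorem MatchingAdeleG₂.cartanObs_eq_zero_iff (hH : (H.map (cmConjRingHom L))ᵀ = H) (hHd : IsUnit H.det)
    (hreg : IsRegularElt ((γ₀ : unitaryGroup (cmConjRingHom L) H).val : GL (Fin 3) L)) [Fintype (cartanIndexCM hH hHd hreg)]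
    (p : MatchingAdeleG₂ L H H γ₀) :
    p.cartanObs hH hHd hreg = 0 ↔ p.cartanObsFun hH hHd hreg = 0 := by
  rw [← Subtype.coe_inj, MatchingAdeleG₂.coe_cartanObs, AddSubgroup.coe_zero]

/-- **THE GLOBAL READING at `cartanObs` (P4 = ★ P5's `hglob`, binder shape VERBATIM)**: for every adelic conjugator `g` of `p`,
`cartanObs p = 0 ↔ ∃ y t, Commute y γ₀ ∧ y⋆ = y ∧ IsUnit (det y) ∧ t (γ₀ ⊗ 1) = (γ₀ ⊗ 1) t ∧ x_g = t⋆ · (y ⊗ 1) · t` (★ (B)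
`cartanObsFun_eq_zero_iff_exists_global`). [cite: Rogawski1990, §3.3 (3.3.1), Prop. 3.3.1 p. 22; §3.5 Prop. 3.5.2 (c) p. 29] [cite: Kottwitz1986, §9] -/
theorem MatchingAdeleG₂.cartanObs_eq_zero_iff_exists_global (hH : (H.map (cmConjRingHom L))ᵀ = H) (hHd : IsUnit H.det)
    (hreg : IsRegularElt ((γ₀ : unitaryGroup (cmConjRingHom L) H).val : GL (Fin 3) L)) [Fintype (cartanIndexCM hH hHd hreg)]
    (p : MatchingAdeleG₂ L H H γ₀) (g : GL (Fin 3) (AdeleRing (𝓞 L) L))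
    (hg : g * (((UnitaryGroup.cmDatum L 3 H).toAdelic γ₀).val : GL (Fin 3) (AdeleRing (𝓞 L) L)) * g⁻¹ = (p.adele.val : GL (Fin 3) (AdeleRing (𝓞 L) L))) :
    p.cartanObs hH hHd hreg = 0 ↔
      ∃ (y : Matrix (Fin 3) (Fin 3) L) (t : GL (Fin 3) (AdeleRing (𝓞 L) L)),
        Commute y (((γ₀ : unitaryGroup (cmConjRingHom L) H).val : GL (Fin 3) L) : Matrix (Fin 3) (Fin 3) L) ∧
        hermStar (cmConjRingHom L) H y = y ∧ IsUnit y.det ∧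
        t * (((UnitaryGroup.cmDatum L 3 H).toAdelic γ₀).val : GL (Fin 3) (AdeleRing (𝓞 L) L)) = (((UnitaryGroup.cmDatum L 3 H).toAdelic γ₀).val : GL (Fin 3) (AdeleRing (𝓞 L) L)) * t ∧
        (H.map (algebraMap L (AdeleRing (𝓞 L) L)))⁻¹ * twistGram (adeleConj L) (H.map (algebraMap L (AdeleRing (𝓞 L) L))) (g : Matrix (Fin 3) (Fin 3) (AdeleRing (𝓞 L) L)) =
          hermStar (adeleConj L) (H.map (algebraMap L (AdeleRing (𝓞 L) L))) (t : Matrix (Fin 3) (Fin 3) (AdeleRing (𝓞 L) L)) * y.map (algebraMap L (AdeleRing (𝓞 L) L)) * (t : Matrix (Fin 3) (Fin 3) (AdeleRing (𝓞 L) L)) :=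
  (p.cartanObs_eq_zero_iff hH hHd hreg).trans (p.cartanObsFun_eq_zero_iff_exists_global hH hHd hreg g hg)

/-- **`cartanObs` is a class function on `𝒞′_𝐀(γ₀)`** (★ (E) `cartanObsFun_eq_of_isConjAdele`). [cite: Rogawski1990, §3.3 (3.3.1) p. 22] [cite: Kottwitz1986, §9] -/
theorem MatchingAdeleG₂.cartanObs_eq_of_isConjAdele (hH : (H.map (cmConjRingHom L))ᵀ = H) (hHd : IsUnit H.det)
    (hreg : IsRegularElt ((γ₀ : unitaryGroup (cmConjRingHom L) H).val : GL (Fin 3) L)) [Fintype (cartanIndexCM hH hHd hreg)]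
    {p q : MatchingAdeleG₂ L H H γ₀} (hpq : p.IsConjAdele q) : p.cartanObs hH hHd hreg = q.cartanObs hH hHd hreg :=
  Subtype.ext (MatchingAdeleG₂.cartanObsFun_eq_of_isConjAdele hH hHd hreg hpq)

end Subgroup

end Literature.NumberTheory.Rogawski1990

end
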